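import Literature.NumberTheory.EllipticCurves.BoxerDiao2010.TwoSelmerTwists
import Literature.NumberTheory.EllipticCurves.BoxerDiao2010.TamagawaTwistOddPrimeProofs
import Literature.NumberTheory.EllipticCurves.BoxerDiao2010.TamagawaTwistAtTwoProofs
import Literature.NumberTheory.EllipticCurves.TamagawaRingEquivProofs
import Literature.NumberTheory.EllipticCurves.TamagawaSubgroupProofs
import Literature.NumberTheory.EllipticCurves.BSDInvariantsTamagawaProofs
import Literature.NumberTheory.EllipticCurves.QuadraticTwistPadicReduction
import Literature.NumberTheory.DiophantineGeometry.MinimalDiscriminantRingOfIntegersProofs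
import Mathlib.NumberTheory.Padics.HeightOneSpectrum
import HarnessLib

/-!
# Boxer–Diao 2010, Prop. 4.1 (the parity of the Tamagawa product of `E^{(d)}`) — PROVED:
# `BoxerDiao2010.prop41_tamagawa_twist_holds`

`Proofs`/`Holds` file (theorems only: no definition, no named fact, no instance), topic
`Literature/NumberTheory/EllipticCurves`, namespace `Literature.NumberTheory.EllipticCurves.BoxerDiao2010`.
It discharges the named fact `Literature.NumberTheory.EllipticCurves.BoxerDiao2010.prop41_tamagawa_twist`
(`TwoSelmerTwists.lean`; G. Boxer, P. Diao, *2-Selmer groups of quadratic twists of elliptic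
curves*, Proc. AMS 138 (2010), Prop. 4.1, p. 1976: for a good `E/ℚ` and a square-free `d`,
(1) if `(d, Δ) = 1` then `∏_p c_p(E^{(d)})` is odd iff `d` is 2-trivial for `E`; (2) if
`(d, Δ) > 1` then `∏_p c_p(E^{(d)})` is even) by FOLLOWING THE PRINTED PROOF (pp. 1976–1977),
prime by prime, on explicit minimal local models — the tree's "index route" to Tamagawa numbers
(`c_v = [E(K_v) : E₀(K_v)]`, `Tamagawa.lean`), without Néron models:

* the minimal model `y² + y = x³ + a₂x² + a₄x + a₆` of a good `E` (Boxer–Diao p. 1971 Remark) is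
  the integral model `M = (0, a₂, 1, a₄, a₆)` of the globally minimal `W`; the twist `W^{(d)}`
  (`WeierstrassCurve.quadraticTwist`) is `ℚ`-isomorphic to the integer model
  `J = (0, 4da₂, 0, 16d²a₄, 16d³(4a₆+1))` (`smul_quadraticTwist_eq_map_twistIntModel`), and
  `c_p(W') = c_p(J)` for every model `W'` of the twist (model independence,
  `localTamagawaNumber_variableChange_holds`);
* `p = 2`: `c₂ = 1` (`TamagawaTwistAtTwoProofs`: good reduction / type II / type II*);
* `p` odd: `TamagawaTwistOddPrimeProofs` (good ⇒ `1`; multiplicative with `v_p(Δ)` odd ⇒ odd;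
  `p ∣ d`, `p ∤ Δ` ⇒ `1` or even according as `E mod p` has a point of order `2`; `p ∣ (d, Δ)` ⇒
  even), where "`E` has no 2-torsion mod `p`" (`BoxerDiao2010.IsTwoTrivial`, on
  `reductionModPrime W p`) is translated into "the cubic `4x³ + 4a₂x² + 4a₄x + 4a₆ + 1` has no root
  mod `p`" (`exists_root_of_two_torsion`, `exists_two_torsion_of_root`: a point of order `2` on
  `y² + y = f(x)` has `y = −½`);
* assembly over the places of `ℚ` (`tamagawaProduct = ∏ᶠ_v c_v`, `c_v = c_p` by
  `localTamagawaNumber_padic_eq_holds`; a single even factor makes the product even, all factors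
  odd make it odd).

Nothing new is asserted: one named fact is discharged (net debt −1); the hypothesis
`#Sel₂(E) = 1` of "good" is not used by Prop. 4.1 (as in print).

## References

* G. Boxer, P. Diao, *2-Selmer groups of quadratic twists of elliptic curves*, Proc. Amer. Math.
  Soc. 138 (2010) 1969–1978, Prop. 4.1 (p. 1976) and its proof (pp. 1976–1977). [BoxerDiao2010]
* J. H. Silverman, *The Arithmetic of Elliptic Curves*, 2nd ed. (2009), VII.1, VII.6, X.5 Cor. 5.4;
  *Advanced Topics* (1994), IV.9.4 (Tate's algorithm). [SilvermanAEC2009] [SilvermanATAEC1994]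
-/

noncomputable section

open scoped Classical

open IsLocalRing WeierstrassCurve IsDedekindDomain NumberField

namespace Literature.NumberTheory.EllipticCurves

namespace BoxerDiao2010

/-! ### The integer model of a good curve and the integer twist model -/

section Model

variable (W : WeierstrassCurve ℚ) [W.IsGloballyMinimal]

/-- `a₁(M) = 0` for the integral model `M` of `W` when `a₁(W) = 0`. [folklore] -/
private theorem integralModelInt_a₁_eq_zero (h : W.a₁ = 0) : (integralModelInt W).a₁ = 0 := by
  have e := congrArg WeierstrassCurve.a₁ (map_integralModelInt W)
  rw [map_a₁, eq_intCast, h] at e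
  exact_mod_cast e

/-- `a₃(M) = 1` for the integral model `M` of `W` when `a₃(W) = 1`. [folklore] -/
private theorem integralModelInt_a₃_eq_one (h : W.a₃ = 1) : (integralModelInt W).a₃ = 1 := by
  have e := congrArg WeierstrassCurve.a₃ (map_integralModelInt W)
  rw [map_a₃, eq_intCast, h] at e
  exact_mod_cast e

/-- **The twist `W^{(d)}` is `ℚ`-isomorphic to the integer model `J = (0, 4da₂, 0, 16d²a₄, 16d³(4a₆+1))`**
(`W = (0, a₂, 1, a₄, a₆)` globally minimal): `W^{(d)} = (0, d b₂/4, 0, d² b₄/2, d³ b₆/4)` with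
`b₂ = 4a₂`, `b₄ = 2a₄`, `b₆ = 4a₆ + 1`, rescaled by `u = ½` (Silverman *AEC* III.1 Table 3.1;
Boxer–Diao 2010, proof of Prop. 4.1: "`E^{(d)} : y² = d³f(x/d)`").
[cite: BoxerDiao2010, proof of Prop. 4.1 (p. 1977)] [cite: SilvermanAEC2009, III.1 Table 3.1] -/
theorem smul_quadraticTwist_eq_map_twistIntModel (h1 : W.a₁ = 0) (h3 : W.a₃ = 1) (d : ℤ) :
    (⟨Units.mk0 (2⁻¹ : ℚ) (by norm_num), 0, 0, 0⟩ : VariableChange ℚ) • W.quadraticTwist (d : ℚ) =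
      (⟨0, 4 * d * (integralModelInt W).a₂, 0, 16 * d ^ 2 * (integralModelInt W).a₄,
          16 * d ^ 3 * (4 * (integralModelInt W).a₆ + 1)⟩ : WeierstrassCurve ℤ).map
        (Int.castRingHom ℚ) := by
  have hW : W = (integralModelInt W).map (Int.castRingHom ℚ) := (map_integralModelInt W).symm
  have hM1 := integralModelInt_a₁_eq_zero W h1
  have hM3 := integralModelInt_a₃_eq_one W h3
  set M := integralModelInt W with hM
  have ha₂ : W.a₂ = (M.a₂ : ℚ) := by
    have e := congrArg WeierstrassCurve.a₂ hW; rwa [map_a₂, eq_intCast] at e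
  have ha₄ : W.a₄ = (M.a₄ : ℚ) := by
    have e := congrArg WeierstrassCurve.a₄ hW; rwa [map_a₄, eq_intCast] at e
  have ha₆ : W.a₆ = (M.a₆ : ℚ) := by
    have e := congrArg WeierstrassCurve.a₆ hW; rwa [map_a₆, eq_intCast] at e
  ext
  · simp [variableChange_a₁]
  · simp only [variableChange_a₂, quadraticTwist_a₁, quadraticTwist_a₂, WeierstrassCurve.b₂, h1,
      ha₂, map_a₂, eq_intCast, Units.val_inv_eq_inv_val, Units.val_mk0, inv_inv, Int.cast_mul,
      Int.cast_ofNat]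
    field_simp
    ring
  · simp [variableChange_a₃]
  · simp only [variableChange_a₄, quadraticTwist_a₁, quadraticTwist_a₃, quadraticTwist_a₄,
      WeierstrassCurve.b₄, h1, h3, ha₄, map_a₄, eq_intCast, Units.val_inv_eq_inv_val,
      Units.val_mk0, inv_inv, Int.cast_mul, Int.cast_pow, Int.cast_ofNat]
    field_simp
    ring
  · simp only [variableChange_a₆, quadraticTwist_a₁, quadraticTwist_a₃, quadraticTwist_a₄,
      quadraticTwist_a₆, WeierstrassCurve.b₆, h3, ha₆, map_a₆, eq_intCast,
      Units.val_inv_eq_inv_val, Units.val_mk0, inv_inv, Int.cast_mul, Int.cast_pow, Int.cast_add,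
      Int.cast_one, Int.cast_ofNat]
    field_simp
    ring

end Model

/-! ### Points of order `2` on `y² + y = x³ + ā₂x² + ā₄x + ā₆` over `𝔽_p`, `p` odd -/

section TwoTorsion

variable (M : WeierstrassCurve ℤ) (hM1 : M.a₁ = 0) (hM3 : M.a₃ = 1) (p : ℕ) [hp : Fact p.Prime]
include hM1 hM3

/-- **A point of order `2` on `M mod p` gives a root of `h(x) = 4x³ + 4ā₂x² + 4ā₄x + 4ā₆ + 1`**: a
point `(x, y)` with `2(x, y) = 𝒪` has `y = −y − 1`, so `(2y + 1)² = 0 = 4(y² + y) + 1 = h(x)`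
(Boxer–Diao 2010, proof of Prop. 4.1: "the number of roots … is just the number of 2-torsion of
`E` mod `p`"). [cite: BoxerDiao2010, proof of Prop. 4.1 (p. 1977)] -/
theorem exists_root_of_two_torsion {Q : (M.map (Int.castRingHom (ZMod p))).toAffine.Point}
    (h2 : (2 : ℕ) • Q = 0) (hQ : Q ≠ 0) :
    ∃ x : ZMod p, 4 * x ^ 3 + 4 * (M.a₂ : ZMod p) * x ^ 2 + 4 * (M.a₄ : ZMod p) * x +
      (4 * (M.a₆ : ZMod p) + 1) = 0 := by
  rcases Q with _ | ⟨x, y, hxy⟩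
  · exact (hQ rfl).elim
  · refine ⟨x, ?_⟩
    rw [two_nsmul, ← eq_neg_iff_add_eq_zero, Affine.Point.neg_some, Affine.Point.some.injEq] at h2
    obtain ⟨-, hy⟩ := h2
    have heq := hxy.1
    rw [Affine.equation_iff] at heq
    simp only [Affine.negY, map_a₁, map_a₂, map_a₃, map_a₄, map_a₆, eq_intCast, hM1, hM3,
      Int.cast_zero, Int.cast_one, zero_mul, sub_zero, add_zero, one_mul] at hy heq
    linear_combination (-4 : ZMod p) * heq + (2 * y + 1) * hy

/-- **Conversely a root of `h` mod `p` (`p ∤ 2Δ(M)`) gives a point of order `2` on `M mod p`**: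
`(x, −½)` lies on `y² + y = x³ + ā₂x² + ā₄x + ā₆` and equals its negative.
[cite: BoxerDiao2010, proof of Prop. 4.1 (p. 1977)] -/
theorem exists_two_torsion_of_root (hp2 : p ≠ 2) (hΔ : ¬ (p : ℤ) ∣ M.Δ) {x : ZMod p}
    (hx : 4 * x ^ 3 + 4 * (M.a₂ : ZMod p) * x ^ 2 + 4 * (M.a₄ : ZMod p) * x +
      (4 * (M.a₆ : ZMod p) + 1) = 0) :
    ∃ Q : (M.map (Int.castRingHom (ZMod p))).toAffine.Point, (2 : ℕ) • Q = 0 ∧ Q ≠ 0 := by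
  have h2 : (2 : ZMod p) ≠ 0 := by
    intro h
    have : ((2 : ℤ) : ZMod p) = 0 := by exact_mod_cast h
    have h' : (p : ℤ) ∣ 2 := (ZMod.intCast_zmod_eq_zero_iff_dvd 2 p).mp this
    have : p ∣ 2 := by exact_mod_cast h'
    exact hp2 ((Nat.prime_dvd_prime_iff_eq hp.out Nat.prime_two).mp this)
  have h4 : (4 : ZMod p) ≠ 0 := by
    rw [show (4 : ZMod p) = 2 * 2 by norm_num]; exact mul_ne_zero h2 h2
  obtain ⟨y, hy1⟩ : ∃ y : ZMod p, 2 * y + 1 = 0 :=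
    ⟨-(2 : ZMod p)⁻¹, by rw [mul_neg, mul_inv_cancel₀ h2, neg_add_cancel]⟩
  set E := M.map (Int.castRingHom (ZMod p)) with hE
  have heq : E.toAffine.Equation x y := by
    rw [Affine.equation_iff]
    simp only [hE, map_a₁, map_a₂, map_a₃, map_a₄, map_a₆, eq_intCast, hM1, hM3, Int.cast_zero,
      Int.cast_one, zero_mul, add_zero, one_mul]
    have h0 : 4 * (y ^ 2 + y - (x ^ 3 + (M.a₂ : ZMod p) * x ^ 2 + (M.a₄ : ZMod p) * x +
        (M.a₆ : ZMod p))) = 0 := by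
      linear_combination (2 * y + 1) * hy1 - hx
    linear_combination (mul_eq_zero.mp h0).resolve_left h4
  haveI : E.IsElliptic := by
    rw [WeierstrassCurve.isElliptic_iff, hE, map_Δ, eq_intCast, isUnit_iff_ne_zero, Ne,
      ZMod.intCast_zmod_eq_zero_iff_dvd]
    exact hΔ
  have hns : E.toAffine.Nonsingular x y := Affine.equation_iff_nonsingular.mp heq
  refine ⟨.some _ _ hns, ?_, Affine.Point.some_ne_zero hns⟩
  rw [two_nsmul, ← eq_neg_iff_add_eq_zero, Affine.Point.neg_some]
  refine point_some_congr rfl ?_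
  simp only [Affine.negY, hE, map_a₁, map_a₃, eq_intCast, hM1, hM3, Int.cast_zero, Int.cast_one,
    zero_mul, sub_zero]
  linear_combination hy1

end TwoTorsion

/-! ### Global-to-local bookkeeping over `ℚ` -/

section Local

/-- **A global minimal model is `ℤ_p`-minimal in Mathlib's `ℚ_[p]`** (transport of minimality at
the place over `p` along `ℚ_v ≃ ℚ_[p]`, `O_v ≃ ℤ_[p]`; Silverman, *AEC* VIII.8).
[cite: SilvermanAEC2009, VIII.8 (definition of a global minimal equation)] -/
theorem isMinimal_baseChange_padic (W : WeierstrassCurve ℚ) [hW : W.IsGloballyMinimal] (p : ℕ)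
    [hp : Fact p.Prime] : (W.baseChange ℚ_[p]).IsMinimal ℤ_[p] := by
  obtain ⟨v, hv⟩ : ∃ v : HeightOneSpectrum (𝓞 ℚ),
      ((Rat.HeightOneSpectrum.primesEquiv v : Nat.Primes) : ℕ) = p :=
    ⟨Rat.HeightOneSpectrum.primesEquiv.symm ⟨p, hp.out⟩, by rw [Equiv.apply_symm_apply]⟩
  subst hv
  haveI := hW.isMinimal v
  have hc : ∀ r : v.adicCompletionIntegers ℚ,
      (Rat.HeightOneSpectrum.adicCompletion.padicEquiv v).toRingEquiv
          (algebraMap _ (v.adicCompletion ℚ) r) =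
        algebraMap ℤ_[Rat.HeightOneSpectrum.primesEquiv v] ℚ_[Rat.HeightOneSpectrum.primesEquiv v]
          ((Rat.HeightOneSpectrum.adicCompletionIntegers.padicIntEquiv v).toRingEquiv r) :=
    fun r ↦ rfl
  have key : ∀ {Y : WeierstrassCurve ℚ_[(Rat.HeightOneSpectrum.primesEquiv v : Nat.Primes)]},
      (W.baseChange (v.adicCompletion ℚ)).map
          ((Rat.HeightOneSpectrum.adicCompletion.padicEquiv v).toRingEquiv :
            v.adicCompletion ℚ →+* ℚ_[(Rat.HeightOneSpectrum.primesEquiv v : Nat.Primes)]) = Y →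
        Y.IsMinimal ℤ_[(Rat.HeightOneSpectrum.primesEquiv v : Nat.Primes)] := by
    rintro Y rfl
    exact isMinimal_map_ringEquiv
      (Rat.HeightOneSpectrum.adicCompletionIntegers.padicIntEquiv v).toRingEquiv
      (Rat.HeightOneSpectrum.adicCompletion.padicEquiv v).toRingEquiv hc _
  refine key ?_
  rw [baseChange, baseChange, map_map]
  congr 1
  exact Subsingleton.elim _ _

/-- **Multiplicative reduction at `p` forces `p ∤ c₄(M)`** for the integral model `M` of a globally
minimal `W` (Silverman, *AEC* VII.5 Prop. 5.1(b): a minimal equation has multiplicative reduction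
iff `v(Δ) > 0`, `v(c₄) = 0`; model independence of the reduction type among minimal equations).
[cite: SilvermanAEC2009, VII.5 Prop. 5.1(b)] -/
theorem not_dvd_c₄_of_hasMultiplicativeReductionAtPrime (W : WeierstrassCurve ℚ) [W.IsElliptic]
    [W.IsGloballyMinimal] (p : ℕ) [Fact p.Prime] (h : W.HasMultiplicativeReductionAtPrime p) :
    ¬ (p : ℤ) ∣ (integralModelInt W).c₄ := by
  haveI := isMinimal_baseChange_padic W p
  haveI : (W.baseChange ℚ_[p]).IsElliptic := by unfold baseChange; infer_instance
  have hΔ : (W.baseChange ℚ_[p]).Δ ≠ 0 := (W.baseChange ℚ_[p]).isUnit_Δ.ne_zero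
  have hmult : (W.baseChange ℚ_[p]).HasMultiplicativeReduction ℤ_[p] :=
    (WeierstrassCurve.hasMultiplicativeReduction_iff_of_isMinimal_of_eq_smul ℤ_[p]
      (W₂ := (W.baseChange ℚ_[p]).minimal ℤ_[p])
      (D := ((W.baseChange ℚ_[p]).exists_isMinimal ℤ_[p]).choose) rfl hΔ).mp h
  have hc₄ := hmult.multiplicativeReduction
  have hφ : (algebraMap ℚ ℚ_[p]).comp (Int.castRingHom ℚ) =
      (algebraMap ℤ_[p] ℚ_[p]).comp (Int.castRingHom ℤ_[p]) := RingHom.ext_int _ _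
  have hW : W.baseChange ℚ_[p] = ((integralModelInt W).map (Int.castRingHom ℤ_[p])).baseChange ℚ_[p] := by
    conv_lhs => rw [← map_integralModelInt W]
    rw [baseChange, baseChange, map_map, map_map, hφ]
  rw [hW, baseChange, map_c₄, map_c₄, eq_intCast,
    IsDedekindDomain.HeightOneSpectrum.valuation_eq_one_iff_notMem] at hc₄
  refine fun hdvd => hc₄ ?_
  change ((integralModelInt W).c₄ : ℤ_[p]) ∈ IsLocalRing.maximalIdeal ℤ_[p]
  rw [PadicInt.maximalIdeal_eq_span_p, Ideal.mem_span_singleton]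
  obtain ⟨c, hc⟩ := hdvd
  exact ⟨(c : ℤ_[p]), by rw [hc]; push_cast; ring⟩

/-- `c_p ∣ ∏_v c_v`: the `p`-adic local Tamagawa number divides the Tamagawa product (it is the
factor at the place over `p`, `localTamagawaNumber_padic_eq_holds`, of a `finprod` with finite
support). [cite: SilvermanAEC2009, Cor. VII.6.2] -/
theorem localTamagawaNumber_padic_dvd_tamagawaProduct (W : WeierstrassCurve ℚ) [W.IsElliptic]
    (p : ℕ) [hp : Fact p.Prime] :
    (W.baseChange ℚ_[p]).localTamagawaNumber ℤ_[p] ∣ W.tamagawaProduct := by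
  set v : HeightOneSpectrum (𝓞 ℚ) := Rat.HeightOneSpectrum.primesEquiv.symm ⟨p, hp.out⟩ with hvdef
  have hv : (Rat.HeightOneSpectrum.primesEquiv v : ℕ) = p := by simp [hvdef]
  rw [WeierstrassCurve.localTamagawaNumber_padic_eq_holds W v p hv]
  exact finprod_mem_dvd v W.mulSupport_localTamagawaNumber_finite_holds

/-- If every `p`-adic local Tamagawa number is odd, the Tamagawa product is odd (`∏ᶠ_v c_v` with
`c_v = c_p`, `p` below `v`). [folklore] -/
private theorem odd_tamagawaProduct_of_forall (W : WeierstrassCurve ℚ) [W.IsElliptic]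
    (h : ∀ (p : ℕ) [Fact p.Prime], Odd ((W.baseChange ℚ_[p]).localTamagawaNumber ℤ_[p])) :
    Odd W.tamagawaProduct := by
  unfold WeierstrassCurve.tamagawaProduct
  refine finprod_induction (p := Odd) odd_one (fun _ _ ha hb => ha.mul hb) fun v => ?_
  haveI : Fact (Nat.Prime (Rat.HeightOneSpectrum.primesEquiv v : ℕ)) :=
    ⟨(Rat.HeightOneSpectrum.primesEquiv v).2⟩
  rw [← WeierstrassCurve.localTamagawaNumber_padic_eq_holds W v _ rfl]
  exact h _

variable (W : WeierstrassCurve ℚ) [W.IsElliptic] [W.IsGloballyMinimal] (h1 : W.a₁ = 0)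
  (h3 : W.a₃ = 1) {d : ℤ} (hd0 : d ≠ 0) (W' : WeierstrassCurve ℚ)
  (C : VariableChange ℚ) (hC : C • W' = W.quadraticTwist (d : ℚ))
include h1 h3 hd0 hC

/-- **`c_p(W') = c_p(J)`**: the local Tamagawa number at `p` of any model `W'` of the twist
`W^{(d)}` is that of the integer model `J = (0, 4da₂, 0, 16d²a₄, 16d³(4a₆+1))` over `ℤ_p`
(model independence of `c_p`, Silverman *AEC* VII.6 Ex. 7.6; `smul_quadraticTwist_eq_map_twistIntModel`).
[cite: SilvermanAEC2009, VII.6 Ex. 7.6 with VII.1 Prop. 1.3(b)] -/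
theorem localTamagawaNumber_padic_eq_twistIntModel (p : ℕ) [Fact p.Prime] :
    (W'.baseChange ℚ_[p]).localTamagawaNumber ℤ_[p] =
      (((⟨0, 4 * d * (integralModelInt W).a₂, 0, 16 * d ^ 2 * (integralModelInt W).a₄,
          16 * d ^ 3 * (4 * (integralModelInt W).a₆ + 1)⟩ : WeierstrassCurve ℤ).map
        (Int.castRingHom ℤ_[p])).baseChange ℚ_[p]).localTamagawaNumber ℤ_[p] := by
  set J : WeierstrassCurve ℤ := ⟨0, 4 * d * (integralModelInt W).a₂, 0,
    16 * d ^ 2 * (integralModelInt W).a₄, 16 * d ^ 3 * (4 * (integralModelInt W).a₆ + 1)⟩ with hJ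
  set C₂ : VariableChange ℚ := ⟨Units.mk0 (2⁻¹ : ℚ) (by norm_num), 0, 0, 0⟩ with hC₂
  have hdq : (d : ℚ) ≠ 0 := by exact_mod_cast hd0
  haveI : (W.quadraticTwist (d : ℚ)).IsElliptic := W.isElliptic_quadraticTwist hdq
  haveI hXe : ((W.quadraticTwist (d : ℚ)).baseChange ℚ_[p]).IsElliptic := by
    unfold baseChange; infer_instance
  have hJq : C₂ • W.quadraticTwist (d : ℚ) = J.map (Int.castRingHom ℚ) :=
    smul_quadraticTwist_eq_map_twistIntModel W h1 h3 d
  -- `W' ⊗ ℚ_p = C⁻¹ • (W^{(d)} ⊗ ℚ_p)`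
  have hW' : W' = C⁻¹ • W.quadraticTwist (d : ℚ) := eq_inv_smul_iff.mpr hC
  have e1 : W'.baseChange ℚ_[p] =
      (C⁻¹).map (algebraMap ℚ ℚ_[p]) • (W.quadraticTwist (d : ℚ)).baseChange ℚ_[p] := by
    rw [hW', baseChange, baseChange, map_variableChange]
  -- `W^{(d)} ⊗ ℚ_p = C₂⁻¹ • (J ⊗ ℚ_p)`
  have hX : W.quadraticTwist (d : ℚ) = C₂⁻¹ • J.map (Int.castRingHom ℚ) :=
    eq_inv_smul_iff.mpr hJq
  have hφ : (algebraMap ℚ ℚ_[p]).comp (Int.castRingHom ℚ) =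
      (algebraMap ℤ_[p] ℚ_[p]).comp (Int.castRingHom ℤ_[p]) := RingHom.ext_int _ _
  have e2 : (W.quadraticTwist (d : ℚ)).baseChange ℚ_[p] =
      (C₂⁻¹).map (algebraMap ℚ ℚ_[p]) • (J.map (Int.castRingHom ℤ_[p])).baseChange ℚ_[p] := by
    rw [hX, baseChange, ← map_variableChange, baseChange, map_map, map_map, hφ]
  haveI : ((J.map (Int.castRingHom ℤ_[p])).baseChange ℚ_[p]).IsElliptic := by
    rw [WeierstrassCurve.isElliptic_iff]
    have h := ((W.quadraticTwist (d : ℚ)).baseChange ℚ_[p]).isUnit_Δ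
    rw [e2, variableChange_Δ] at h
    exact isUnit_of_mul_isUnit_right h
  rw [e1, localTamagawaNumber_variableChange_holds, e2, localTamagawaNumber_variableChange_holds]

/-- **`c₂(W') = 1`** for any model `W'` of the twist `W^{(d)}`, `4 ∤ d`, of a globally minimal
`W = (0, a₂, 1, a₄, a₆)` (Boxer–Diao 2010, proof of Prop. 4.1: "We claim that `c₂` is always `1`").
[cite: BoxerDiao2010, proof of Prop. 4.1 (pp. 1976–1977)] -/
theorem localTamagawaNumber_two_eq_one (hd4 : ¬ (4 : ℤ) ∣ d) :
    (W'.baseChange ℚ_[2]).localTamagawaNumber ℤ_[2] = 1 := by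
  have hdq : (d : ℚ) ≠ 0 := by exact_mod_cast hd0
  haveI : (W.quadraticTwist (d : ℚ)).IsElliptic := W.isElliptic_quadraticTwist hdq
  haveI hXe : ((W.quadraticTwist (d : ℚ)).baseChange ℚ_[2]).IsElliptic := by
    unfold baseChange; infer_instance
  have hW' : W' = C⁻¹ • W.quadraticTwist (d : ℚ) := eq_inv_smul_iff.mpr hC
  have e1 : W'.baseChange ℚ_[2] =
      (C⁻¹).map (algebraMap ℚ ℚ_[2]) • (W.quadraticTwist (d : ℚ)).baseChange ℚ_[2] := by
    rw [hW', baseChange, baseChange, map_variableChange]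
  have e2 : (W.quadraticTwist (d : ℚ)).baseChange ℚ_[2] =
      (((integralModelInt W).map (Int.castRingHom ℤ_[2])).baseChange ℚ_[2]).quadraticTwist
        (d : ℚ_[2]) := by
    have hφ : (algebraMap ℚ ℚ_[2]).comp (Int.castRingHom ℚ) =
        (algebraMap ℤ_[2] ℚ_[2]).comp (Int.castRingHom ℤ_[2]) := RingHom.ext_int _ _
    rw [baseChange, map_quadraticTwist, map_intCast]
    congr 1
    conv_lhs => rw [← map_integralModelInt W]
    rw [baseChange, map_map, map_map, hφ]
  rw [e1, localTamagawaNumber_variableChange_holds, e2]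
  exact localTamagawaNumber_two_quadraticTwist_model_eq_one (integralModelInt W)
    (integralModelInt_a₁_eq_zero W h1) (integralModelInt_a₃_eq_one W h3) hd4

end Local

/-! ### The discharge -/

/-- A square-free integer divisible by a prime `p` is `p` times an integer prime to `p`. [folklore] -/
private theorem exists_eq_mul_not_dvd_of_squarefree {d : ℤ} (hsq : Squarefree d) {p : ℕ} (hp : p.Prime)
    (hpd : (p : ℤ) ∣ d) : ∃ d₁ : ℤ, d = p * d₁ ∧ ¬ (p : ℤ) ∣ d₁ := by
  obtain ⟨d₁, rfl⟩ := hpd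
  refine ⟨d₁, rfl, fun ⟨e, he⟩ => ?_⟩
  have hunit : IsUnit (p : ℤ) := hsq (p : ℤ) ⟨e, by rw [he]; ring⟩
  rcases Int.isUnit_iff.mp hunit with h | h
  · exact hp.one_lt.ne' (by exact_mod_cast h)
  · have : (0 : ℤ) ≤ (p : ℤ) := by exact_mod_cast p.zero_le
    omega

/-- **Boxer–Diao 2010, Proposition 4.1 — PROVED** (discharge of the named fact
`BoxerDiao2010.prop41_tamagawa_twist`, Proc. AMS 138, p. 1976): for a good `E/ℚ` (globally minimal
`W` with `IsGood W`), a square-free `d` and a globally minimal model `W'` of `E^{(d)}`,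
(1) if `(d, Δ) = 1` then `∏_p c_p(E^{(d)})` is odd iff `d` is 2-trivial for `E`;
(2) if `(d, Δ) > 1` then `∏_p c_p(E^{(d)})` is even. Proof as printed (pp. 1976–1977), prime by
prime on explicit minimal local models: `c₂ = 1` (`TamagawaTwistAtTwoProofs`); at odd `p ∤ dΔ`
`c_p = 1`; at odd `p ∣ Δ`, `p ∤ d`, `c_p ∈ {1, v_p(Δ)}` is odd; at odd `p ∣ d`, `p ∤ Δ` (type
`I₀*`) `c_p` is `1` or even according as `E mod p` has no or some point of order `2`; at
`p ∣ (d, Δ)` (type `Iₙ*`) `c_p` is even (`TamagawaTwistOddPrimeProofs`); assembly over the places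
of `ℚ`. The Selmer hypothesis (1) of "good" is not used, as in print.
[cite: BoxerDiao2010, Prop. 4.1 (p. 1976) and its proof (pp. 1976–1977)] -/
theorem prop41_tamagawa_twist_holds : prop41_tamagawa_twist := by
  intro W _ _ hgood d hsq W' _ _ hW'
  obtain ⟨-, -, hbad, h1, h3⟩ := hgood
  obtain ⟨C, hC⟩ := hW'
  set M := integralModelInt W with hMdef
  have hM1 : M.a₁ = 0 := integralModelInt_a₁_eq_zero W h1
  have hM3 : M.a₃ = 1 := integralModelInt_a₃_eq_one W h3
  have hΔM : minimalDiscriminantInt W = M.Δ := rfl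
  have hd0 : d ≠ 0 := hsq.ne_zero
  have hMΔ0 : M.Δ ≠ 0 := hΔM ▸ minimalDiscriminantInt_ne_zero W
  have hMΔodd : Odd M.Δ := odd_Δ_of_a₁_eq_zero_of_a₃_eq_one M hM1 hM3
  set J : WeierstrassCurve ℤ := ⟨0, 4 * d * M.a₂, 0, 16 * d ^ 2 * M.a₄,
    16 * d ^ 3 * (4 * M.a₆ + 1)⟩ with hJ
  -- per-prime bookkeeping
  have key : ∀ (p : ℕ) [Fact p.Prime], (W'.baseChange ℚ_[p]).localTamagawaNumber ℤ_[p] =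
      ((J.map (Int.castRingHom ℤ_[p])).baseChange ℚ_[p]).localTamagawaNumber ℤ_[p] :=
    fun p _ => localTamagawaNumber_padic_eq_twistIntModel W h1 h3 hd0 W' C hC p
  have hd4 : ¬ (4 : ℤ) ∣ d := fun ⟨e, he⟩ => by
    have hunit : IsUnit (2 : ℤ) := hsq 2 ⟨e, by rw [he]; ring⟩
    rcases Int.isUnit_iff.mp hunit with h | h <;> omega
  have key2 : (W'.baseChange ℚ_[2]).localTamagawaNumber ℤ_[2] = 1 :=
    localTamagawaNumber_two_eq_one W h1 h3 hd0 W' C hC hd4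
  -- odd primes dividing `Δ(M)` do not divide `c₄(M)` (multiplicative reduction)
  have hc₄ : ∀ (p : ℕ) [Fact p.Prime], (p : ℤ) ∣ M.Δ → ¬ (p : ℤ) ∣ M.c₄ := fun p _ hpΔ =>
    not_dvd_c₄_of_hasMultiplicativeReductionAtPrime W p (hbad p (hΔM ▸ hpΔ)).1
  have hp2_of_dvd_Δ : ∀ p : ℕ, p.Prime → (p : ℤ) ∣ M.Δ → p ≠ 2 := by
    rintro p hp hpΔ rfl
    exact (Int.not_even_iff_odd.mpr hMΔodd) (even_iff_two_dvd.mpr (by exact_mod_cast hpΔ))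
  refine ⟨fun hgcd => ⟨fun hodd => ?_, fun htriv => ?_⟩, fun hgcd => ?_⟩
  · -- (1), `⇒`: an odd Tamagawa product forces `d` to be 2-trivial
    intro p _ hp2 hpd Q h2Q
    by_contra hQ
    have hpΔ : ¬ (p : ℤ) ∣ M.Δ := fun hpΔ => by
      have h1' : (p : ℤ) ∣ (Int.gcd d (minimalDiscriminantInt W) : ℤ) :=
        Int.dvd_coe_gcd hpd (hΔM ▸ hpΔ)
      rw [hgcd, Nat.cast_one] at h1'
      exact (Fact.out : p.Prime).one_lt.ne' (by exact_mod_cast Int.eq_one_of_dvd_one (by positivity) h1')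
    obtain ⟨x, hx⟩ := exists_root_of_two_torsion M hM1 hM3 p h2Q hQ
    obtain ⟨d₁, hd₁, hpd₁⟩ := exists_eq_mul_not_dvd_of_squarefree hsq (Fact.out : p.Prime) hpd
    have h2c : 2 ∣ (W'.baseChange ℚ_[p]).localTamagawaNumber ℤ_[p] := by
      rw [key p]
      exact two_dvd_localTamagawaNumber_twistIntModel_of_dvd_of_root p M hM1 hM3 d J hJ hd₁ hp2
        hpd₁ hpΔ ⟨x, hx⟩
    exact (Nat.not_even_iff_odd.mpr hodd)
      (even_iff_two_dvd.mpr (h2c.trans (localTamagawaNumber_padic_dvd_tamagawaProduct W' p)))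
  · -- (1), `⇐`: every local factor is odd
    refine odd_tamagawaProduct_of_forall W' fun p _ => ?_
    by_cases hp2 : p = 2
    · subst hp2; rw [key2]; exact odd_one
    rw [key p]
    by_cases hpd : (p : ℤ) ∣ d
    · have hpΔ : ¬ (p : ℤ) ∣ M.Δ := fun hpΔ => by
        have h1' : (p : ℤ) ∣ (Int.gcd d (minimalDiscriminantInt W) : ℤ) :=
          Int.dvd_coe_gcd hpd (hΔM ▸ hpΔ)
        rw [hgcd, Nat.cast_one] at h1'
        exact (Fact.out : p.Prime).one_lt.ne'
          (by exact_mod_cast Int.eq_one_of_dvd_one (by positivity) h1')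
      obtain ⟨d₁, hd₁, hpd₁⟩ := exists_eq_mul_not_dvd_of_squarefree hsq (Fact.out : p.Prime) hpd
      rw [localTamagawaNumber_twistIntModel_eq_one_of_dvd_of_no_root p M hM1 hM3 d J hJ hd₁ hp2
        hpd₁ hpΔ fun x hx => ?_]
      · exact odd_one
      obtain ⟨Q, h2Q, hQ⟩ := exists_two_torsion_of_root M hM1 hM3 p hp2 hpΔ hx
      exact hQ (htriv p hp2 hpd Q h2Q)
    · by_cases hpΔ : (p : ℤ) ∣ M.Δ
      · exact odd_localTamagawaNumber_twistIntModel_of_dvd_Δ p M hM1 hM3 d J hJ hp2 hpd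
          (hc₄ p hpΔ) hMΔ0 (hbad p (hΔM ▸ hpΔ)).2
      · rw [localTamagawaNumber_twistIntModel_eq_one_of_not_dvd p M hM1 hM3 d J hJ hp2 hpd hpΔ]
        exact odd_one
  · -- (2): a prime `p ∣ (d, Δ)` gives an even `c_p`
    have hg0 : Int.gcd d (minimalDiscriminantInt W) ≠ 1 := hgcd
    obtain ⟨p, hp, hpg⟩ := Nat.exists_prime_and_dvd hg0
    haveI : Fact p.Prime := ⟨hp⟩
    have hpd : (p : ℤ) ∣ d :=
      (Int.natCast_dvd_natCast.mpr hpg).trans (Int.gcd_dvd_left (a := d) (b := minimalDiscriminantInt W))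
    have hpΔ : (p : ℤ) ∣ M.Δ :=
      hΔM ▸ (Int.natCast_dvd_natCast.mpr hpg).trans
        (Int.gcd_dvd_right (a := d) (b := minimalDiscriminantInt W))
    have hp2 : p ≠ 2 := hp2_of_dvd_Δ p hp hpΔ
    obtain ⟨d₁, hd₁, hpd₁⟩ := exists_eq_mul_not_dvd_of_squarefree hsq hp hpd
    have h2c : 2 ∣ (W'.baseChange ℚ_[p]).localTamagawaNumber ℤ_[p] := by
      rw [key p]
      exact two_dvd_localTamagawaNumber_twistIntModel_of_dvd_of_dvd_Δ p M hM1 hM3 d J hJ hd₁ hp2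
        hpd₁ hpΔ (hc₄ p hpΔ) hMΔ0
    exact even_iff_two_dvd.mpr (h2c.trans (localTamagawaNumber_padic_dvd_tamagawaProduct W' p))

end BoxerDiao2010

end Literature.NumberTheory.EllipticCurves

end
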